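import Literature.Probability.RandomPlanarGeometry.SAWRestrictionCovariance
import Literature.Probability.RandomPlanarGeometry.SAWEdgeListSurgery
import Literature.Probability.RandomPlanarGeometry.PolylineShellTraversals
import Literature.Probability.RandomPlanarGeometry.CurveTortuosity
import Literature.Probability.LatticeModels.MeshDomainJordan
import Literature.Probability.LatticeModels.LatticeDobrushinDomain
import Summits.CriticalPhenomena.SAWScalingLimit.Theorems.SAWRenewalTightnessEventualTightArcFibre
import Summits.CriticalPhenomena.SAWScalingLimit.Theorems.SAWRenewalTightnessEventualTightArcMarkov
import Summits.CriticalPhenomena.SAWScalingLimit.Theorems.SAWRenewalTightnessEventualTightTravTransport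
import Summits.CriticalPhenomena.SAWScalingLimit.Theorems.SAWRenewalTightnessEventualTightVirginConfig
import HarnessLib

/-!
# `EventualTight`, line `Sketch` v7: the VIRGINIZATION glue (V4) — the virgin-arc count atom gives the bulk leaf at aspect two

Crux stmt-CriticalPhenomena-1372 (`SAWRenewalTightness.EventualTight`; bulk child `BulkShellTight`, stmt-17588), line
`Sketch`, registration v7 (lead c4).  The two-sided domain-Markov reduction ("virginization", `Cruxes/EventualTight/
MERGE-c3.md` §5, count form, list level) of per-shell traversal-count tightness on INTERIOR shells of aspect two to the
pure lattice atom X2c₁ `stub_virginArcTraversalTight` (the hypothesis below, verbatim its registered signature): for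
every `θ > 0` there are `k, N₀` such that for every configuration `(H, Λ)` VIRGIN in the closed lattice disc
`B̄(z₀, N)`, `N ≥ N₀` (`H ≤ ℤ²`, every lattice point of the disc allowed, every lattice edge of `B̄(z₀, N+1)` an
`H`-edge, nothing assumed outside) and every two doors `(u, c)`, `(u', c')`, the `x_c`-mass of the self-avoiding
`H`-arcs `c → c'` in `Λ` whose vertex sequence makes `k` weak traversals of `D(z₀; 2N/5, 3N/5)` is `≤ θ ·` (mass of
all arcs).

Proof (`bulkShellTightAtAspectTwo_of_virginArcTraversalTight`), composing the four LANDED rungs of the line: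
for an interior shell `D(y; η, 2η)` with `B̄(y, 4η) ⊆ Ω` take the cut radius `R_c = 3η` (room `e = η`), the shrunk
shell `η' = 6η/5`, `R' = 9η/5` (so that `D(z₀; η'/δ, R'/δ) = D(z₀; 2N/5, 3N/5)` for `N = R_c/δ`, `z₀ = y/δ`); X2c₁
at `θ = ε` gives `k, N₀`; the mesh threshold is the minimum of V2's (`Theorems.stub_travTransport`, p141996), V3's
(`Theorems.stub_virginConfig`, p141593), the endpoint thresholds (`δ a_δ`, `δ b_δ` outside `B̄(y, R_c)` by the
endpoint limits and `a, b ∈ ∂Ω ∌ B̄(y, 4η)` — Disproof §2 spent here) and `R_c/N₀`; at such a mesh the domain-Markov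
inequality V1 (`Theorems.stub_arcMarkov`, p141673, fed with `Theorems.stub_arcFibre`, p141866) with
`far v ⇔ N < dist(v, z₀)`, `E` = "`k+1` separate traversals of `D(y; η, 2η)`", `A` = "`k+1` weak vertex traversals
of `D(z₀; η'/δ, R'/δ)` by the middle piece" bounds `weight E ≤ ε · Z`: every walk of `E` enters the cut disc and
`E ⇒ A` on the middle piece (V2), every cut configuration is virgin with doors (V3) so X2c₁ applies (`k+1 → k` by
`vertexTraversals_of_le`); hence `law E ≤ ε`.  Together with the aspect reduction `stub_aspectReduction`
(`BulkShellTightAtAspectTwo → BulkShellTight`) this closes the bulk child modulo X2c₁.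
-/

noncomputable section

open MeasureTheory Filter Topology Set Metric
open scoped ENNReal NNReal unitInterval
open Literature.Probability.RandomPlanarGeometry Literature.Probability.LatticeModels

namespace Summit.CriticalPhenomena.SAWScalingLimit.Theorems


/-- Fewer weak vertex traversals are easier, for the traversal mass of arcs: the `x_c`-mass of the self-avoiding
`H`-arcs `c → c'` in `Λ` whose vertex sequence makes `k+1` weak traversals of `D(z₀; n, R)` is at most the mass of
those making `k` (pointwise inclusion of the subtypes, `vertexTraversals_of_le`, `ENNReal.tsum_comp_le_tsum_of_injective`).
[folklore] -/
theorem tsum_vertexTraversals_succ_le (H : SimpleGraph (Site 2)) (Λ : Set (Site 2)) (c c' : Site 2) (k : ℕ)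
    (z₀ : ℂ) (n R : ℝ) :
    ∑' p : {p : {p : H.Walk c c' // p.IsPath ∧ ∀ v ∈ p.support, v ∈ Λ} //
        ∃ ι κ : Fin (k + 1) → Fin (p.1.support.map Site.toComplex).length, (∀ m, ι m ≤ κ m) ∧
          (∀ m, (dist ((p.1.support.map Site.toComplex).get (ι m)) z₀ ≤ n ∧
              R ≤ dist ((p.1.support.map Site.toComplex).get (κ m)) z₀) ∨
            (R ≤ dist ((p.1.support.map Site.toComplex).get (ι m)) z₀ ∧
              dist ((p.1.support.map Site.toComplex).get (κ m)) z₀ ≤ n)) ∧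
          ∀ ⦃m m'⦄, m < m' → κ m ≤ ι m'},
        ENNReal.ofReal (SAW.criticalFugacity ^ p.1.1.length) ≤
      ∑' p : {p : {p : H.Walk c c' // p.IsPath ∧ ∀ v ∈ p.support, v ∈ Λ} //
        ∃ ι κ : Fin k → Fin (p.1.support.map Site.toComplex).length, (∀ m, ι m ≤ κ m) ∧
          (∀ m, (dist ((p.1.support.map Site.toComplex).get (ι m)) z₀ ≤ n ∧
              R ≤ dist ((p.1.support.map Site.toComplex).get (κ m)) z₀) ∨
            (R ≤ dist ((p.1.support.map Site.toComplex).get (ι m)) z₀ ∧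
              dist ((p.1.support.map Site.toComplex).get (κ m)) z₀ ≤ n)) ∧
          ∀ ⦃m m'⦄, m < m' → κ m ≤ ι m'},
        ENNReal.ofReal (SAW.criticalFugacity ^ p.1.1.length) := by
  let f : {p : {p : H.Walk c c' // p.IsPath ∧ ∀ v ∈ p.support, v ∈ Λ} //
        ∃ ι κ : Fin (k + 1) → Fin (p.1.support.map Site.toComplex).length, (∀ m, ι m ≤ κ m) ∧
          (∀ m, (dist ((p.1.support.map Site.toComplex).get (ι m)) z₀ ≤ n ∧
              R ≤ dist ((p.1.support.map Site.toComplex).get (κ m)) z₀) ∨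
            (R ≤ dist ((p.1.support.map Site.toComplex).get (ι m)) z₀ ∧
              dist ((p.1.support.map Site.toComplex).get (κ m)) z₀ ≤ n)) ∧
          ∀ ⦃m m'⦄, m < m' → κ m ≤ ι m'} →
      {p : {p : H.Walk c c' // p.IsPath ∧ ∀ v ∈ p.support, v ∈ Λ} //
        ∃ ι κ : Fin k → Fin (p.1.support.map Site.toComplex).length, (∀ m, ι m ≤ κ m) ∧
          (∀ m, (dist ((p.1.support.map Site.toComplex).get (ι m)) z₀ ≤ n ∧
              R ≤ dist ((p.1.support.map Site.toComplex).get (κ m)) z₀) ∨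
            (R ≤ dist ((p.1.support.map Site.toComplex).get (ι m)) z₀ ∧
              dist ((p.1.support.map Site.toComplex).get (κ m)) z₀ ≤ n)) ∧
          ∀ ⦃m m'⦄, m < m' → κ m ≤ ι m'} :=
    fun p => ⟨p.1, vertexTraversals_of_le p.2 (Nat.le_succ k)⟩
  have hf : Function.Injective f := fun p q hpq => by
    apply Subtype.ext
    have h := congrArg Subtype.val hpq
    exact h
  exact ENNReal.tsum_comp_le_tsum_of_injective hf _

/-- **V4 — the virginization glue: the virgin-arc count atom X2c₁ gives per-shell traversal-count tightness on
interior shells of aspect two** (`BulkShellTightAtAspectTwo`, the hypothesis of the registered aspect reduction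
`stub_aspectReduction`).  See the module docstring for the proof; the hypothesis is verbatim the registered stub
`stub_virginArcTraversalTight` of the line `Sketch` v7.
[cite: DuminilCopinSmirnov2012, §2 (domain Markov property)] [cite: AizenmanBurchardDuke1999, §3.a] -/
theorem bulkShellTightAtAspectTwo_of_virginArcTraversalTight :
    (∀ θ : ℝ, 0 < θ →
      ∃ (k : ℕ) (N₀ : ℝ), 0 < N₀ ∧
        ∀ (H : SimpleGraph (Site 2)) (Λ : Set (Site 2)) (z₀ : ℂ) (N : ℝ) (u c u' c' : Site 2),
          N₀ ≤ N →
          (H ≤ zdGraph 2 ∧ (∀ v : Site 2, dist (Site.toComplex v) z₀ ≤ N → v ∈ Λ) ∧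
            ∀ v v' : Site 2, dist (Site.toComplex v) z₀ ≤ N + 1 →
              dist (Site.toComplex v') z₀ ≤ N + 1 → (zdGraph 2).Adj v v' → H.Adj v v') →
          (H.Adj u c ∧ u ∉ Λ ∧ c ∈ Λ ∧ dist (Site.toComplex c) z₀ ≤ N ∧
            N < dist (Site.toComplex u) z₀) →
          (H.Adj u' c' ∧ u' ∉ Λ ∧ c' ∈ Λ ∧ dist (Site.toComplex c') z₀ ≤ N ∧
            N < dist (Site.toComplex u') z₀) →
          ∑' p : {p : {p : H.Walk c c' // p.IsPath ∧ ∀ v ∈ p.support, v ∈ Λ} //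
              ∃ ι κ : Fin k → Fin (p.1.support.map Site.toComplex).length, (∀ m, ι m ≤ κ m) ∧
                (∀ m, (dist ((p.1.support.map Site.toComplex).get (ι m)) z₀ ≤ 2 * N / 5 ∧
                    3 * N / 5 ≤ dist ((p.1.support.map Site.toComplex).get (κ m)) z₀) ∨
                  (3 * N / 5 ≤ dist ((p.1.support.map Site.toComplex).get (ι m)) z₀ ∧
                    dist ((p.1.support.map Site.toComplex).get (κ m)) z₀ ≤ 2 * N / 5)) ∧
                ∀ ⦃m m'⦄, m < m' → κ m ≤ ι m'},
              ENNReal.ofReal (SAW.criticalFugacity ^ p.1.1.length) ≤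
            ENNReal.ofReal θ *
              ∑' p : {p : H.Walk c c' // p.IsPath ∧ ∀ v ∈ p.support, v ∈ Λ},
                ENNReal.ofReal (SAW.criticalFugacity ^ p.1.length)) →
    ∀ (D : DobrushinDomain) (a b : ℝ → Site 2), SAW.IsEndpointApprox D a b →
      ∀ (y : ℂ) (η : ℝ), 0 < η → Metric.closedBall y (4 * η) ⊆ D.carrier →
        ∀ ε : ℝ, 0 < ε → ∃ (j : ℕ) (δ₁ : ℝ), 0 < δ₁ ∧ ∀ δ ∈ Set.Ioc (0 : ℝ) δ₁,
          SAW.law D.carrier δ (a δ) (b δ)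
            {γ | (⟨γ.walk.toCurve (meshPoint δ)⟩ : Curve ℂ).HasTraversals j y η (2 * η)} ≤
            ENNReal.ofReal ε := by
  intro hX D a b hab y η hη hball ε hε
  -- radii
  set R : ℝ := 2 * η with hR_def
  have hR : 0 < R := by rw [hR_def]; linarith
  set η' : ℝ := 6 * η / 5 with hη'_def
  set R' : ℝ := 9 * η / 5 with hR'_def
  set Rc : ℝ := 3 * η with hRc_def
  have hηη' : η < η' := by rw [hη'_def]; linarith
  have hη'R' : η' < R' := by rw [hη'_def, hR'_def]; linarith
  have hR'R : R' < R := by rw [hR'_def, hR_def]; linarith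
  have hRRc : R < Rc := by rw [hRc_def, hR_def]; linarith
  have hRc : 0 < Rc := hR.trans hRRc
  -- X2c₁, V2, V3
  obtain ⟨k, N₀, hN₀, hXk⟩ := hX ε hε
  obtain ⟨δ₂, hδ₂, hT'⟩ := stub_travTransport y η η' R' R Rc hη hηη' hη'R' hR'R hRRc
  have hball' : Metric.closedBall y (Rc + η) ⊆ D.carrier := by
    have : Rc + η = 4 * η := by rw [hRc_def]; ring
    rw [this]; exact hball
  obtain ⟨δ₃, hδ₃, hV'⟩ := stub_virginConfig D y Rc η hRc hη hball'
  -- the marked points are outside `B̄(y, 4η)`, so the lattice endpoints leave `B̄(y, R_c)` eventually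
  have hout : ∀ i : Fin 2, Rc < dist (D.pt i) y := fun i => by
    refine lt_of_not_ge fun h => ?_
    have hmem : D.pt i ∈ D.carrier :=
      hball (Metric.mem_closedBall.2 (h.trans (by rw [hRc_def]; linarith)))
    have hfr := D.pt_mem_frontier i
    rw [frontier, interior_eq_iff_isOpen.2 D.isOpen] at hfr
    exact hfr.2 hmem
  have hopen : IsOpen {z : ℂ | Rc < dist z y} :=
    isOpen_lt continuous_const (continuous_id.dist continuous_const)
  obtain ⟨δa, hδa, hsubA⟩ := mem_nhdsGT_iff_exists_Ioo_subset.1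
    (hab.tendsto_fst.eventually_mem (hopen.mem_nhds (hout 0)))
  obtain ⟨δb, hδb, hsubB⟩ := mem_nhdsGT_iff_exists_Ioo_subset.1
    (hab.tendsto_snd.eventually_mem (hopen.mem_nhds (hout 1)))
  have hδa0 : (0 : ℝ) < δa := hδa
  have hδb0 : (0 : ℝ) < δb := hδb
  -- the mesh threshold
  refine ⟨k + 1, min (min δ₂ δ₃) (min (min (δa / 2) (δb / 2)) (Rc / N₀)), ?_, fun δ hδ => ?_⟩
  · refine lt_min (lt_min hδ₂ hδ₃) (lt_min (lt_min (half_pos hδa0) (half_pos hδb0)) ?_)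
    positivity
  obtain ⟨hδ0, hδle⟩ := hδ
  have hδδ₂ : δ ≤ δ₂ := hδle.trans ((min_le_left _ _).trans (min_le_left _ _))
  have hδδ₃ : δ ≤ δ₃ := hδle.trans ((min_le_left _ _).trans (min_le_right _ _))
  have hδδa : δ < δa :=
    (hδle.trans ((min_le_right _ _).trans ((min_le_left _ _).trans (min_le_left _ _)))).trans_lt
      (half_lt_self hδa0)
  have hδδb : δ < δb :=
    (hδle.trans ((min_le_right _ _).trans ((min_le_left _ _).trans (min_le_right _ _)))).trans_lt
      (half_lt_self hδb0)
  have hδN₀ : δ ≤ Rc / N₀ := hδle.trans ((min_le_right _ _).trans (min_le_right _ _))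
  -- lattice centre, cut radius, the far predicate
  set z₀ : ℂ := (δ : ℂ)⁻¹ * y with hz₀_def
  set N : ℝ := Rc / δ with hN_def
  have hδC : (δ : ℂ) ≠ 0 := Complex.ofReal_ne_zero.2 hδ0.ne'
  have hz₀ : (δ : ℂ) * z₀ = y := by rw [hz₀_def, ← mul_assoc, mul_inv_cancel₀ hδC, one_mul]
  have hN : δ * N = Rc := by rw [hN_def]; field_simp
  have hN₀N : N₀ ≤ N := by
    rw [hN_def, le_div_iff₀ hδ0]
    calc N₀ * δ ≤ N₀ * (Rc / N₀) := by gcongr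
      _ = Rc := by field_simp
  have hdist : ∀ v : Site 2, dist (meshPoint δ v) y = δ * dist (Site.toComplex v) z₀ := fun v => by
    rw [← hz₀, meshPoint, dist_eq_norm, dist_eq_norm, ← mul_sub, norm_mul, Complex.norm_real,
      Real.norm_of_nonneg hδ0.le]
  set far : Site 2 → Bool := fun v => decide (N < dist (Site.toComplex v) z₀) with hfar_def
  have hfar_true : ∀ v, far v = true ↔ N < dist (Site.toComplex v) z₀ := fun v => by
    simp [hfar_def]
  have hfar_false : ∀ v, far v = false ↔ dist (Site.toComplex v) z₀ ≤ N := fun v => by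
    simp [hfar_def]
  have hfar_of_mesh : ∀ v : Site 2, Rc < dist (meshPoint δ v) y → far v = true := fun v hv => by
    rw [hfar_true, hN_def, div_lt_iff₀ hδ0, mul_comm]
    rwa [hdist] at hv
  have ha₀ : far (a δ) = true := hfar_of_mesh _ (hsubA ⟨hδ0, hδδa⟩)
  have hb₀ : far (b δ) = true := hfar_of_mesh _ (hsubB ⟨hδ0, hδδb⟩)
  -- V2 and V3 at this mesh
  have hTδ := hT' δ ⟨hδ0, hδδ₂⟩ z₀ N hz₀ hN
  have hVδ := hV' δ ⟨hδ0, hδδ₃⟩ z₀ N hz₀ hN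
  -- the event and the domain-Markov inequality (V1)
  set E : Set (SAW.DomainSAW D.carrier δ (a δ) (b δ)) :=
    {γ | (⟨γ.walk.toCurve (meshPoint δ)⟩ : Curve ℂ).HasTraversals (k + 1) y η R} with hE_def
  have hW : SAW.weight D.carrier δ (a δ) (b δ) E ≤
      ENNReal.ofReal ε * SAW.weight D.carrier δ (a δ) (b δ) Set.univ := by
    refine stub_arcMarkov stub_arcFibre D.carrier δ (a δ) (b δ) far E
      (fun α => ∃ ι κ : Fin (k + 1) → Fin (α.map Site.toComplex).length, (∀ m, ι m ≤ κ m) ∧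
        (∀ m, (dist ((α.map Site.toComplex).get (ι m)) z₀ ≤ η' / δ ∧
            R' / δ ≤ dist ((α.map Site.toComplex).get (κ m)) z₀) ∨
          (R' / δ ≤ dist ((α.map Site.toComplex).get (ι m)) z₀ ∧
            dist ((α.map Site.toComplex).get (κ m)) z₀ ≤ η' / δ)) ∧
        ∀ ⦃m m'⦄, m < m' → κ m ≤ ι m')
      (ENNReal.ofReal ε) ha₀ hb₀ ?_ ?_ ?_
    · -- every walk of `E` enters the closed cut disc
      intro γ hγ
      obtain ⟨v, hv, hvN⟩ := (hTδ D.carrier (a δ) (b δ) γ (k + 1) hγ).1 (Nat.le_add_left 1 k)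
      exact ⟨v, hv, (hfar_false v).2 hvN⟩
    · -- `E` implies `A` on the middle piece
      intro γ hγ β α β' c c' u u' hL hc hc' hu hu' _ _ hβ hβ'
      exact (hTδ D.carrier (a δ) (b δ) γ (k + 1) hγ).2 β α β' c c' u u' hL hc hc' hu hu'
        (fun v hv => (hfar_true v).1 (hβ v hv)) (fun v hv => (hfar_true v).1 (hβ' v hv))
    · -- the arc inequality on every fibre: virgin configuration + doors (V3), then X2c, then `k+1 → k`
      intro γ _ β α β' c c' u u' hL hc hc' hu hu' hfc hfc' hβ hβ'
      obtain ⟨hvirgin, hdoor, hdoor'⟩ := hVδ (a δ) (b δ) γ β α β' c c' u u' hL hc hc' hu hu'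
        ((hfar_false c).1 hfc) ((hfar_false c').1 hfc')
        (fun v hv => (hfar_true v).1 (hβ v hv)) (fun v hv => (hfar_true v).1 (hβ' v hv))
      have hXthis := hXk (discreteDomainGraph D.carrier δ) {v : Site 2 | v ∉ β ∧ v ∉ β'} z₀ N
        u c u' c' hN₀N hvirgin hdoor hdoor'
      have hNA : 2 * N / 5 = η' / δ := by
        rw [hN_def, hη'_def, hRc_def]; field_simp; ring
      have hNB : 3 * N / 5 = R' / δ := by
        rw [hN_def, hR'_def, hRc_def]; field_simp; ring
      rw [hNA, hNB] at hXthis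
      exact le_trans (tsum_vertexTraversals_succ_le (discreteDomainGraph D.carrier δ)
        {v : Site 2 | v ∉ β ∧ v ∉ β'} c c' k z₀ (η' / δ) (R' / δ)) hXthis
  -- conclude: `law E = Z⁻¹ · weight E ≤ ε`
  rw [SAW.law_apply_eq_inv_mul_weight]
  calc (SAW.weight D.carrier δ (a δ) (b δ) Set.univ)⁻¹ * SAW.weight D.carrier δ (a δ) (b δ) E
      ≤ (SAW.weight D.carrier δ (a δ) (b δ) Set.univ)⁻¹ *
          (ENNReal.ofReal ε * SAW.weight D.carrier δ (a δ) (b δ) Set.univ) := by gcongr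
    _ = ENNReal.ofReal ε * ((SAW.weight D.carrier δ (a δ) (b δ) Set.univ)⁻¹ *
          SAW.weight D.carrier δ (a δ) (b δ) Set.univ) := by rw [mul_left_comm]
    _ ≤ ENNReal.ofReal ε * 1 := by gcongr; exact ENNReal.inv_mul_le_one _
    _ = ENNReal.ofReal ε := mul_one _

end Summit.CriticalPhenomena.SAWScalingLimit.Theorems

end
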